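import Summits.ValiantsHypothesis.ValiantsHypothesis.Theorems.BarrierLeverAnchoredDoorHitsLowerPairsSplitGeneralRows

/-!
# Support item `AnchoredDoorHitsLowerPairs` (stmt-ValiantsHypothesis-22510), line `anchored-peeling`:
# CONJECTURE SP for all `m` — part 5b: THE EDGE COLUMNS OF THE LIMIT DESIGN AT EVERY ROW (convolutions)

Helper file (`--supports stmt-ValiantsHypothesis-22510`; cell valiant-natproofs, rung V4, 𝒟-side door (c); registered line
`Cruxes/AnchoredDoorHitsLowerPairs/Lines/anchored_peeling.lean` v24, registered stub `stub_splitFamilyGe3`; prover seat val-np-p1 gen 24;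
memo HOME/val-np-p1/g24/MEMO-SP-proof-valnp1-g24.md §2.2, §6 B3). Closes NO item.

WHAT. Continuation of `…SplitGeneralRows`: the clique vertex as a combination of row deltas on every face of the cube (`vtopN_clique_eq`), and the
convolutions giving the EDGE columns of the limit design evaluated at every row — `conv_vv_rowC` (persona ⋆ persona + persona ⋆ α-part,
α ⋆ α = 0) and `conv_vu_rowC` (clique ⋆ independent).

WHAT THIS IS NOT: nothing on crux stmt-ValiantsHypothesis-14610 or on `VP` versus `VNP`.
-/

set_option linter.dupNamespace false

namespace Summit.ValiantsHypothesis.ValiantsHypothesis.Theorems.BarrierLever.AnchoredPeeling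

namespace SplitGeneral

open Finset DecFamily

section Adm

variable {m : ℕ}

/-! ## 3. Convolutions at rows -/

section ConvSum

variable {α : Type*} [DecidableEq α] {ι : Type*}

/-- Convolution distributes over finite sums (left). -/
theorem conv_finset_sum_left (s : Finset ι) (f : ι → Finset α → ℂ) (g : Finset α → ℂ) (U : Finset α) :
    conv (fun C => ∑ i ∈ s, f i C) g U = ∑ i ∈ s, conv (f i) g U := by
  unfold conv
  rw [Finset.sum_comm]
  exact Finset.sum_congr rfl (fun V _ => by rw [Finset.sum_mul])

/-- Convolution distributes over finite sums (right). -/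
theorem conv_finset_sum_right (s : Finset ι) (f : Finset α → ℂ) (g : ι → Finset α → ℂ) (U : Finset α) :
    conv f (fun C => ∑ i ∈ s, g i C) U = ∑ i ∈ s, conv f (g i) U := by
  rw [conv_comm, conv_finset_sum_left]
  exact Finset.sum_congr rfl (fun i _ => conv_comm _ _ _)

end ConvSum

/-- The index set of the `α`-atoms: pairs `(S', T')`, `S' ⊆ range (m+1)`, `T' ⊆ range m`. -/
def atoms (m : ℕ) : Finset (Finset ℕ × Finset ℕ) := (range (m + 1)).powerset ×ˢ (range m).powerset

/-- Membership in `atoms`. -/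
theorem mem_atoms {p : Finset ℕ × Finset ℕ} : p ∈ atoms m ↔ p.1 ⊆ range (m + 1) ∧ p.2 ⊆ range m := by
  rw [atoms, Finset.mem_product, Finset.mem_powerset, Finset.mem_powerset]

/-- Every face of the `(2m+2)`-cube is a row. -/
theorem exists_rowC_eq {C : Finset ℕ} (hC : C ⊆ range (2 * m + 2)) :
    ∃ S T : Finset ℕ, ∃ e : Bool, S ⊆ range (m + 1) ∧ T ⊆ range m ∧ C = rowC m S e T := by
  classical
  refine ⟨C.filter (fun v => v ≤ m), (range m).filter (fun j => m + 2 + j ∈ C), decide (m + 1 ∈ C),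
    fun v hv => Finset.mem_range.mpr (by have := (Finset.mem_filter.mp hv).2; omega), Finset.filter_subset _ _, ?_⟩
  ext v
  rw [mem_rowC, Finset.mem_filter, mem_sh, Finset.mem_filter, Finset.mem_range]
  constructor
  · intro hv
    have hv' := Finset.mem_range.mp (hC hv)
    by_cases h1 : v ≤ m
    · exact Or.inl ⟨hv, h1⟩
    by_cases h2 : v = m + 1
    · right; left; exact ⟨decide_eq_true (h2 ▸ hv), h2⟩
    · right; right
      refine ⟨by omega, by omega, ?_⟩
      have : m + 2 + (v - (m + 2)) = v := by omega
      rw [this]; exact hv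
  · rintro (⟨hv, _⟩ | ⟨he, rfl⟩ | ⟨_, _, hv⟩)
    · exact hv
    · exact of_decide_eq_true he
    · have : m + 2 + (v - (m + 2)) = v := by omega
      rwa [this] at hv

/-- The clique vertex as a combination of row deltas (valid at every face of the cube). -/
theorem vtopN_clique_eq {P : Finset ℕ} (hP : P ⊆ range (m + 1)) (C : Finset ℕ) (hC : C ⊆ range (2 * m + 2)) :
    vtopN m (enc P) C = ind (P ≠ ∅) * dlt (rowC m P false ∅) C + ∑ p ∈ atoms m, aco m P p.1 p.2 * dlt (rowC m p.1 true p.2) C := by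
  classical
  obtain ⟨S, T, e, hS, hT, rfl⟩ := exists_rowC_eq hC
  rw [vtopN_clique_rowC hP hS hT, dlt_rowC hP hS]
  have hsum : ∑ p ∈ atoms m, aco m P p.1 p.2 * dlt (rowC m p.1 true p.2) (rowC m S e T) = if e = true then aco m P S T else 0 := by
    rw [Finset.sum_eq_single (S, T)]
    · rw [dlt_rowC hS hS]; cases e <;> simp
    · intro p hp hpne
      rw [dlt_rowC (mem_atoms.mp hp).1 hS, if_neg, mul_zero]
      rintro ⟨h1, -, h3⟩
      exact hpne (Prod.ext h1.symm h3.symm)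
    · intro hn; exact absurd (mem_atoms.mpr ⟨hS, hT⟩) hn
  rw [hsum]
  unfold ind
  cases e <;> by_cases hP0 : P = ∅ <;> simp [hP0]

/-- Restricting both arguments of a convolution to subfaces does not change it. -/
theorem conv_congr_subset {f g f' g' : Finset ℕ → ℂ} {U : Finset ℕ} (hf : ∀ V, V ⊆ U → f V = f' V) (hg : ∀ V, V ⊆ U → g V = g' V) :
    conv f g U = conv f' g' U := by
  unfold conv
  exact Finset.sum_congr rfl (fun V hV => by rw [hf V (Finset.mem_powerset.mp hV), hg _ Finset.sdiff_subset])

/-- persona ⋆ α-atoms: `[e][P ⊆ S] · aco P' (S ∖ P) T`. -/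
theorem sum_conv_persona_atoms {P P' S T : Finset ℕ} {e : Bool} (hP : P ⊆ range (m + 1)) (hS : S ⊆ range (m + 1)) (hT : T ⊆ range m) :
    ∑ p ∈ atoms m, aco m P' p.1 p.2 * conv (dlt (rowC m P false ∅)) (dlt (rowC m p.1 true p.2)) (rowC m S e T) =
      ind (e = true ∧ P ⊆ S) * aco m P' (S \ P) T := by
  classical
  have hval : ∀ p ∈ atoms m, aco m P' p.1 p.2 * conv (dlt (rowC m P false ∅)) (dlt (rowC m p.1 true p.2)) (rowC m S e T) =
      if (Disjoint P p.1 ∧ S = P ∪ p.1 ∧ e = true ∧ T = p.2) then aco m P' p.1 p.2 else 0 := by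
    intro p hp
    rw [conv_dlt_rowC hP (mem_atoms.mp hp).1 hS]
    by_cases hc : Disjoint P p.1 ∧ S = P ∪ p.1 ∧ e = true ∧ T = p.2
    · rw [if_pos hc, if_pos, mul_one]
      exact ⟨⟨hc.1, by simp, Finset.disjoint_empty_left _⟩, hc.2.1, by simpa using hc.2.2.1, by simpa using hc.2.2.2⟩
    · rw [if_neg hc, if_neg, mul_zero]
      rintro ⟨⟨hd, -, -⟩, h1, h2, h3⟩
      exact hc ⟨hd, h1, by simpa using h2, by simpa using h3⟩
  rw [Finset.sum_congr rfl hval]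
  unfold ind
  by_cases hc : e = true ∧ P ⊆ S
  · rw [if_pos hc, one_mul, Finset.sum_eq_single (S \ P, T)]
    · rw [if_pos ⟨Finset.disjoint_sdiff, (Finset.union_sdiff_of_subset hc.2).symm, hc.1, rfl⟩]
    · intro p _ hpne
      rw [if_neg]
      rintro ⟨hd, h1, -, h3⟩
      apply hpne
      refine Prod.ext ?_ h3.symm
      show p.1 = S \ P
      rw [h1, Finset.union_sdiff_left, eq_comm, Finset.sdiff_eq_self_iff_disjoint]; exact hd.symm
    · intro hn; exact absurd (mem_atoms.mpr ⟨Finset.sdiff_subset.trans hS, hT⟩) hn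
  · rw [if_neg hc, zero_mul]
    refine Finset.sum_eq_zero (fun p _ => if_neg ?_)
    rintro ⟨_, h1, h2, -⟩
    exact hc ⟨h2, h1 ▸ Finset.subset_union_left⟩

/-- α-atoms ⋆ α-atoms vanish (two `α`'s). -/
theorem sum_conv_atoms_atoms {P P' S T : Finset ℕ} {e : Bool} (hS : S ⊆ range (m + 1)) :
    ∑ p ∈ atoms m, aco m P p.1 p.2 * ∑ q ∈ atoms m, aco m P' q.1 q.2 *
      conv (dlt (rowC m p.1 true p.2)) (dlt (rowC m q.1 true q.2)) (rowC m S e T) = 0 := by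
  refine Finset.sum_eq_zero (fun p hp => ?_)
  rw [Finset.sum_eq_zero (fun q hq => ?_), mul_zero]
  rw [conv_dlt_rowC (mem_atoms.mp hp).1 (mem_atoms.mp hq).1 hS, if_neg, mul_zero]
  rintro ⟨⟨-, h, -⟩, -⟩
  exact Bool.noConfusion h

/-- α-atoms ⋆ independent persona: `[e][t ⊆ T] · aco P S (T ∖ t)`. -/
theorem sum_conv_atoms_indep {P t S T : Finset ℕ} {e : Bool} (hS : S ⊆ range (m + 1)) (hT : T ⊆ range m) :
    ∑ p ∈ atoms m, aco m P p.1 p.2 * conv (dlt (rowC m p.1 true p.2)) (dlt (rowC m ∅ false t)) (rowC m S e T) =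
      ind (e = true ∧ t ⊆ T) * aco m P S (T \ t) := by
  classical
  have hval : ∀ p ∈ atoms m, aco m P p.1 p.2 * conv (dlt (rowC m p.1 true p.2)) (dlt (rowC m ∅ false t)) (rowC m S e T) =
      if (Disjoint p.2 t ∧ S = p.1 ∧ e = true ∧ T = p.2 ∪ t) then aco m P p.1 p.2 else 0 := by
    intro p hp
    rw [conv_dlt_rowC (mem_atoms.mp hp).1 (Finset.empty_subset _) hS]
    by_cases hc : Disjoint p.2 t ∧ S = p.1 ∧ e = true ∧ T = p.2 ∪ t
    · rw [if_pos hc, if_pos, mul_one]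
      exact ⟨⟨Finset.disjoint_empty_right _, by simp, hc.1⟩, by simpa using hc.2.1, by simpa using hc.2.2.1, hc.2.2.2⟩
    · rw [if_neg hc, if_neg, mul_zero]
      rintro ⟨⟨-, -, hd⟩, h1, h2, h3⟩
      exact hc ⟨hd, by simpa using h1, by simpa using h2, h3⟩
  rw [Finset.sum_congr rfl hval]
  unfold ind
  by_cases hc : e = true ∧ t ⊆ T
  · rw [if_pos hc, one_mul, Finset.sum_eq_single (S, T \ t)]
    · rw [if_pos ⟨Finset.sdiff_disjoint, rfl, hc.1, (Finset.sdiff_union_of_subset hc.2).symm⟩]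
    · intro p _ hpne
      rw [if_neg]
      rintro ⟨hd, h1, -, h3⟩
      apply hpne
      refine Prod.ext h1.symm ?_
      show p.2 = T \ t
      rw [h3, Finset.union_sdiff_right, eq_comm, Finset.sdiff_eq_self_iff_disjoint]; exact hd
    · intro hn; exact absurd (mem_atoms.mpr ⟨hS, Finset.sdiff_subset.trans hT⟩) hn
  · rw [if_neg hc, zero_mul]
    refine Finset.sum_eq_zero (fun p _ => if_neg ?_)
    rintro ⟨_, -, h2, h3⟩
    exact hc ⟨h2, h3 ▸ Finset.subset_union_right⟩

/-- **Clique–clique edge column at a row**: persona ⋆ persona + persona ⋆ α-part (both ways); α ⋆ α vanishes. -/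
theorem conv_vv_rowC {P P' S T : Finset ℕ} {e : Bool} (hP : P ⊆ range (m + 1)) (hP' : P' ⊆ range (m + 1)) (hS : S ⊆ range (m + 1))
    (hT : T ⊆ range m) :
    conv (vtopN m (enc P)) (vtopN m (enc P')) (rowC m S e T) =
      ind (P ≠ ∅ ∧ P' ≠ ∅ ∧ Disjoint P P' ∧ S = P ∪ P' ∧ e = false ∧ T = ∅) +
        ind (e = true) * (ind (P ≠ ∅ ∧ P ⊆ S) * aco m P' (S \ P) T + ind (P' ≠ ∅ ∧ P' ⊆ S) * aco m P (S \ P') T) := by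
  classical
  have hrow : rowC m S e T ⊆ range (2 * m + 2) := rowC_subset_range hS hT e
  set fP : Finset ℕ → ℂ := ind (P ≠ ∅) • dlt (rowC m P false ∅) with hfP
  set aP : Finset ℕ → ℂ := fun C => ∑ p ∈ atoms m, aco m P p.1 p.2 * dlt (rowC m p.1 true p.2) C with haP
  set fP' : Finset ℕ → ℂ := ind (P' ≠ ∅) • dlt (rowC m P' false ∅) with hfP'
  set aP' : Finset ℕ → ℂ := fun C => ∑ p ∈ atoms m, aco m P' p.1 p.2 * dlt (rowC m p.1 true p.2) C with haP'
  rw [conv_congr_subset (f' := fP + aP) (g' := fP' + aP')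
    (fun V hV => by rw [vtopN_clique_eq hP V (hV.trans hrow)]; rfl) (fun V hV => by rw [vtopN_clique_eq hP' V (hV.trans hrow)]; rfl)]
  rw [conv_add_left, conv_add_right, conv_add_right]
  -- persona ⋆ persona
  have h1 : conv fP fP' (rowC m S e T) = ind (P ≠ ∅ ∧ P' ≠ ∅ ∧ Disjoint P P' ∧ S = P ∪ P' ∧ e = false ∧ T = ∅) := by
    rw [hfP, hfP', conv_smul_left, conv_smul_right, conv_dlt_rowC hP hP' hS]
    unfold ind
    have hiff : ((Disjoint P P' ∧ (false && false) = false ∧ Disjoint (∅ : Finset ℕ) ∅) ∧ S = P ∪ P' ∧ e = (false || false) ∧ T = ∅ ∪ ∅) ↔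
        (Disjoint P P' ∧ S = P ∪ P' ∧ e = false ∧ T = ∅) := by simp
    by_cases h0 : P = ∅
    · rw [if_neg (not_not.mpr h0), zero_mul, if_neg (fun h => h.1 h0)]
    by_cases h0' : P' = ∅
    · rw [if_neg (not_not.mpr h0'), zero_mul, mul_zero, if_neg (fun h => h.2.1 h0')]
    rw [if_pos h0, if_pos h0', one_mul, one_mul]
    by_cases hc : Disjoint P P' ∧ S = P ∪ P' ∧ e = false ∧ T = ∅
    · rw [if_pos (hiff.mpr hc), if_pos ⟨h0, h0', hc⟩]
    · rw [if_neg (fun h => hc (hiff.mp h)), if_neg (fun h => hc h.2.2)]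
  -- persona ⋆ α
  have h2 : conv fP aP' (rowC m S e T) = ind (e = true) * (ind (P ≠ ∅ ∧ P ⊆ S) * aco m P' (S \ P) T) := by
    rw [hfP, haP', conv_smul_left, conv_finset_sum_right]
    have : ∀ p ∈ atoms m, conv (dlt (rowC m P false ∅)) (fun C => aco m P' p.1 p.2 * dlt (rowC m p.1 true p.2) C) (rowC m S e T) =
        aco m P' p.1 p.2 * conv (dlt (rowC m P false ∅)) (dlt (rowC m p.1 true p.2)) (rowC m S e T) := by
      intro p _; rw [← conv_smul_right]; rfl
    rw [Finset.sum_congr rfl this, sum_conv_persona_atoms hP hS hT]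
    unfold ind
    by_cases h0 : P = ∅ <;> by_cases he : e = true <;> by_cases hs : P ⊆ S <;> simp [h0, he, hs]
  -- α ⋆ persona
  have h3 : conv aP fP' (rowC m S e T) = ind (e = true) * (ind (P' ≠ ∅ ∧ P' ⊆ S) * aco m P (S \ P') T) := by
    rw [conv_comm, haP, hfP', conv_smul_left, conv_finset_sum_right]
    have : ∀ p ∈ atoms m, conv (dlt (rowC m P' false ∅)) (fun C => aco m P p.1 p.2 * dlt (rowC m p.1 true p.2) C) (rowC m S e T) =
        aco m P p.1 p.2 * conv (dlt (rowC m P' false ∅)) (dlt (rowC m p.1 true p.2)) (rowC m S e T) := by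
      intro p _; rw [← conv_smul_right]; rfl
    rw [Finset.sum_congr rfl this, sum_conv_persona_atoms hP' hS hT]
    unfold ind
    by_cases h0 : P' = ∅ <;> by_cases he : e = true <;> by_cases hs : P' ⊆ S <;> simp [h0, he, hs]
  -- α ⋆ α
  have h4 : conv aP aP' (rowC m S e T) = 0 := by
    rw [haP, haP', conv_finset_sum_left]
    have : ∀ p ∈ atoms m, conv (fun C => aco m P p.1 p.2 * dlt (rowC m p.1 true p.2) C)
        (fun C => ∑ q ∈ atoms m, aco m P' q.1 q.2 * dlt (rowC m q.1 true q.2) C) (rowC m S e T) =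
        aco m P p.1 p.2 * ∑ q ∈ atoms m, aco m P' q.1 q.2 * conv (dlt (rowC m p.1 true p.2)) (dlt (rowC m q.1 true q.2)) (rowC m S e T) := by
      intro p _
      rw [show (fun C => aco m P p.1 p.2 * dlt (rowC m p.1 true p.2) C) = aco m P p.1 p.2 • dlt (rowC m p.1 true p.2) from rfl,
        conv_smul_left, conv_finset_sum_right]
      congr 1
      refine Finset.sum_congr rfl (fun q _ => ?_)
      rw [← conv_smul_right]; rfl
    rw [Finset.sum_congr rfl this, sum_conv_atoms_atoms hS]
  rw [h1, h2, h3, h4, add_zero]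
  ring

/-- **Clique–independent edge column at a row**: persona ⋆ persona + α-part ⋆ persona. -/
theorem conv_vu_rowC {P t S T : Finset ℕ} {e : Bool} (hP : P ⊆ range (m + 1)) (ht : t ∈ smallSets m) (hS : S ⊆ range (m + 1))
    (hT : T ⊆ range m) :
    conv (vtopN m (enc P)) (vtopN m (yu m t)) (rowC m S e T) =
      ind (P ≠ ∅ ∧ S = P ∧ e = false ∧ T = t) + ind (e = true ∧ t ⊆ T) * aco m P S (T \ t) := by
  classical
  have hrow : rowC m S e T ⊆ range (2 * m + 2) := rowC_subset_range hS hT e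
  obtain ⟨hy1, hy2, hy3⟩ := yu_spec ht
  have hu : vtopN m (yu m t) = dlt (rowC m ∅ false t) := by
    funext C; unfold vtopN; rw [if_neg hy1, if_pos hy2, hy3, ← rowC_indep, ind]; rfl
  set fP : Finset ℕ → ℂ := ind (P ≠ ∅) • dlt (rowC m P false ∅) with hfP
  set aP : Finset ℕ → ℂ := fun C => ∑ p ∈ atoms m, aco m P p.1 p.2 * dlt (rowC m p.1 true p.2) C with haP
  rw [hu, conv_congr_subset (f' := fP + aP) (g' := dlt (rowC m ∅ false t))
    (fun V hV => by rw [vtopN_clique_eq hP V (hV.trans hrow)]; rfl) (fun V _ => rfl), conv_add_left]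
  have h1 : conv fP (dlt (rowC m ∅ false t)) (rowC m S e T) = ind (P ≠ ∅ ∧ S = P ∧ e = false ∧ T = t) := by
    rw [hfP, conv_smul_left, conv_dlt_rowC hP (Finset.empty_subset _) hS]
    unfold ind
    have hiff : ((Disjoint P ∅ ∧ (false && false) = false ∧ Disjoint (∅ : Finset ℕ) t) ∧ S = P ∪ ∅ ∧ e = (false || false) ∧ T = ∅ ∪ t) ↔
        (S = P ∧ e = false ∧ T = t) := by simp
    by_cases h0 : P = ∅
    · rw [if_neg (not_not.mpr h0), zero_mul, if_neg (fun h => h.1 h0)]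
    rw [if_pos h0, one_mul]
    by_cases hc : S = P ∧ e = false ∧ T = t
    · rw [if_pos (hiff.mpr hc), if_pos ⟨h0, hc⟩]
    · rw [if_neg (fun h => hc (hiff.mp h)), if_neg (fun h => hc h.2)]
  have h2 : conv aP (dlt (rowC m ∅ false t)) (rowC m S e T) = ind (e = true ∧ t ⊆ T) * aco m P S (T \ t) := by
    rw [haP, conv_finset_sum_left]
    have : ∀ p ∈ atoms m, conv (fun C => aco m P p.1 p.2 * dlt (rowC m p.1 true p.2) C) (dlt (rowC m ∅ false t)) (rowC m S e T) =
        aco m P p.1 p.2 * conv (dlt (rowC m p.1 true p.2)) (dlt (rowC m ∅ false t)) (rowC m S e T) := by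
      intro p _
      rw [show (fun C => aco m P p.1 p.2 * dlt (rowC m p.1 true p.2) C) = aco m P p.1 p.2 • dlt (rowC m p.1 true p.2) from rfl,
        conv_smul_left]
    rw [Finset.sum_congr rfl this, sum_conv_atoms_indep hS hT]
  rw [h1, h2]

end Adm

end SplitGeneral

end Summit.ValiantsHypothesis.ValiantsHypothesis.Theorems.BarrierLever.AnchoredPeeling
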